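import Mathlib

/-!
# Exponent bookkeeping for the ladder lift (crux `PrimeTwoFamilies`, stmt-MatrixMultiplication-14308,
line `Sketch`, registered stub `stub_bookkeeping`)

Pure real-exponent bookkeeping for the ladder lift of line `Sketch`
(`CyclicLadderConjecture → PrimeTwoFamilies`).  For `0 < δ ≤ 1` we fix `ε := δ / 8` and the word
length `L := L' + 1` with `L' := ⌈16 / δ⌉₊` (so `δ L' ≥ 16`); then for every `n₀` there is a threshold
`m₀` such that a ladder level `m ≥ m₀` with `r ≥ m ^ (1/2 - ε)` classes, a number `N` of words with
`r ^ L ≤ (L r + 1) N`, and a host prime `p ≤ 2·3^L·m^L` leave room for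
`n := max n₀ ⌈(2·3^L·m^L) ^ (1/(2+δ))⌉₊` pairs: `n₀ ≤ n ≤ N`, `p ≤ n ^ (2+δ)` and
`n ^ (2-δ) ≤ (m ^ (1-ε)) ^ L`.

The only analytic input is `eventually_dominates`: `K · m ^ a ≤ m ^ b` for all large `m` when `a < b`.
It is used twice, with the exponent gaps
* `(L'+1)/(2+δ) < (1/2 - δ/8) · L'` (this is where `δ L' ≥ 16` and `δ ≤ 1` enter), giving `n ≤ N`
  through the counting step `r ^ L' ≤ (L'+2) N` (`pow_le_mul_of_words`);
* `(2-δ)(L'+1)/(2+δ) < (1 - δ/8) · (L'+1)`, giving `n ^ (2-δ) ≤ (m ^ (1-ε)) ^ L`.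
-/

-- single-conjunct summit: the mandated namespace repeats `MatrixMultiplication` (summit = sub-problem).
set_option linter.dupNamespace false

namespace Summit.MatrixMultiplication.MatrixMultiplication.Theorems.PrimeTwoFamilies.LadderLift

/-- A constant multiple of a smaller real power of `m` is eventually dominated by a larger power:
if `0 < K` and `a < b` then `K * m ^ a ≤ m ^ b` for all naturals `m ≥ ⌈K ^ (1/(b-a))⌉₊ + 1`. -/
private theorem eventually_dominates (K a b : ℝ) (hK : 0 < K) (hab : a < b) :
    ∃ m₀ : ℕ, ∀ m : ℕ, m₀ ≤ m → K * (m : ℝ) ^ a ≤ (m : ℝ) ^ b := by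
  have hc : 0 < b - a := sub_pos.mpr hab
  refine ⟨⌈K ^ (b - a)⁻¹⌉₊ + 1, fun m hm => ?_⟩
  have hm1 : ((⌈K ^ (b - a)⁻¹⌉₊ + 1 : ℕ) : ℝ) ≤ m := by exact_mod_cast hm
  push_cast at hm1
  have hceil : K ^ (b - a)⁻¹ ≤ (⌈K ^ (b - a)⁻¹⌉₊ : ℝ) := Nat.le_ceil _
  have hT0 : (0 : ℝ) ≤ K ^ (b - a)⁻¹ := Real.rpow_nonneg hK.le _
  have hKm' : K ^ (b - a)⁻¹ ≤ (m : ℝ) := by linarith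
  have hm0 : (0 : ℝ) < m := by linarith
  have hKm : K ≤ (m : ℝ) ^ (b - a) := by
    calc K = (K ^ (b - a)⁻¹) ^ (b - a) := (Real.rpow_inv_rpow hK.le hc.ne').symm
      _ ≤ (m : ℝ) ^ (b - a) := Real.rpow_le_rpow hT0 hKm' hc.le
  calc K * (m : ℝ) ^ a ≤ (m : ℝ) ^ (b - a) * (m : ℝ) ^ a :=
        mul_le_mul_of_nonneg_right hKm (Real.rpow_nonneg hm0.le _)
    _ = (m : ℝ) ^ b := by rw [← Real.rpow_add hm0, sub_add_cancel]

/-- The counting step behind `n ≤ N`, in `ℕ`: if `1 ≤ r` and `r ^ (L'+1) ≤ ((L'+1) r + 1) N` then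
`r ^ L' ≤ (L'+2) N` (bound the `+ 1` by `r` and cancel one factor `r`). -/
private theorem pow_le_mul_of_words (r L' N : ℕ) (hr : 1 ≤ r)
    (h : r ^ (L' + 1) ≤ ((L' + 1) * r + 1) * N) : r ^ L' ≤ (L' + 2) * N := by
  have h2 : r ^ L' * r ≤ (L' + 2) * N * r := by
    calc r ^ L' * r = r ^ (L' + 1) := (pow_succ r L').symm
      _ ≤ ((L' + 1) * r + 1) * N := h
      _ ≤ ((L' + 1) * r + r) * N := Nat.mul_le_mul_right N (Nat.add_le_add_left hr _)
      _ = (L' + 2) * N * r := by ring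
  exact Nat.le_of_mul_le_mul_right h2 hr

/-- **Stub `stub_bookkeeping`** (exponent bookkeeping of line `Sketch`): for `0 < δ ≤ 1` one can fix
`ε > 0` and a word length `L`, and then for every `n₀` a threshold `m₀`, such that a ladder level
`m ≥ m₀` with `r ≥ m ^ (1/2-ε)` classes, `N ≥ r ^ L / (L r + 1)` words, and a host prime
`p ≤ 2·3^L·m^L` leaves room for a number `n` of pairs with `n₀ ≤ n ≤ N`, `p ≤ n ^ (2+δ)` and
`n ^ (2-δ) ≤ (m ^ (1-ε)) ^ L`.  Choice: `ε = δ/8`, `L = ⌈16/δ⌉₊ + 1`,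
`n = max n₀ ⌈(2·3^L·m^L) ^ (1/(2+δ))⌉₊`. -/
theorem stub_bookkeeping (δ : ℝ) (hδ : 0 < δ) (hδ1 : δ ≤ 1) :
    ∃ ε : ℝ, 0 < ε ∧ ∃ L : ℕ, ∀ n₀ : ℕ, ∃ m₀ : ℕ, ∀ m : ℕ, m₀ ≤ m →
      ∀ r : ℕ, (m : ℝ) ^ (1 / 2 - ε) ≤ (r : ℝ) →
      ∀ N : ℕ, r ^ L ≤ (L * r + 1) * N →
      ∀ p : ℕ, p ≤ 2 * (3 ^ L * m ^ L) →
        ∃ n : ℕ, n₀ ≤ n ∧ n ≤ N ∧ (p : ℝ) ≤ (n : ℝ) ^ (2 + δ) ∧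
          (n : ℝ) ^ (2 - δ) ≤ ((m : ℝ) ^ (1 - ε)) ^ L := by
  /- word length `L = L' + 1` with `δ L' ≥ 16` (`L' = ⌈16/δ⌉₊`) -/
  obtain ⟨L', hL'⟩ : ∃ L' : ℕ, 16 ≤ δ * (L' : ℝ) := by
    refine ⟨⌈16 / δ⌉₊, ?_⟩
    have h := Nat.le_ceil (16 / δ)
    rw [div_le_iff₀ hδ] at h
    linarith
  refine ⟨δ / 8, by positivity, L' + 1, fun n₀ => ?_⟩
  /- the two exponent gaps -/
  have h2δ : (0 : ℝ) < 2 + δ := by positivity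
  have hgap₁ : ((L' : ℝ) + 1) / (2 + δ) < (1 / 2 - δ / 8) * L' := by
    rw [div_lt_iff₀ h2δ]
    nlinarith [mul_le_mul_of_nonneg_right hL' (by linarith : (0 : ℝ) ≤ 1 / 4 - δ / 8)]
  have hM : (0 : ℝ) < (L' : ℝ) + 1 := by positivity
  have hgap₂ : ((L' : ℝ) + 1) / (2 + δ) * (2 - δ) < (1 - δ / 8) * ((L' : ℝ) + 1) := by
    rw [div_mul_eq_mul_div, div_lt_iff₀ h2δ]
    nlinarith [mul_pos hM hδ, mul_le_mul_of_nonneg_left hδ1 (le_of_lt (mul_pos hM hδ))]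
  /- constants `C = 2·3^L`, `K = n₀ + 1 + C ^ (1/(2+δ))`, and the threshold `m₀` -/
  have hC0 : (0 : ℝ) < 2 * 3 ^ (L' + 1) := by positivity
  have hK0 : (0 : ℝ) < (n₀ : ℝ) + 1 + (2 * 3 ^ (L' + 1)) ^ (2 + δ)⁻¹ := by positivity
  set C : ℝ := 2 * 3 ^ (L' + 1) with hC
  set K : ℝ := (n₀ : ℝ) + 1 + C ^ (2 + δ)⁻¹ with hK
  obtain ⟨m₁, hm₁⟩ := eventually_dominates (K * ((L' : ℝ) + 2)) _ _
    (mul_pos hK0 (by positivity)) hgap₁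
  obtain ⟨m₂, hm₂⟩ := eventually_dominates (K ^ (2 - δ)) _ _ (Real.rpow_pos_of_pos hK0 _) hgap₂
  refine ⟨max 1 (max m₁ m₂), fun m hm r hr N hN p hp => ?_⟩
  have hm1 : 1 ≤ m := le_trans (le_max_left _ _) hm
  have hmm₁ : m₁ ≤ m := le_trans (le_trans (le_max_left _ _) (le_max_right _ _)) hm
  have hmm₂ : m₂ ≤ m := le_trans (le_trans (le_max_right _ _) (le_max_right _ _)) hm
  have hm1R : (1 : ℝ) ≤ m := by exact_mod_cast hm1
  have hm0R : (0 : ℝ) ≤ m := zero_le_one.trans hm1R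
  /- the number of pairs kept: `n = max n₀ n₁`, `n₁ = ⌈X ^ (1/(2+δ))⌉₊`, `X = C m^L` -/
  set X : ℝ := C * (m : ℝ) ^ (L' + 1) with hX
  have hX0 : 0 ≤ X := mul_nonneg hC0.le (by positivity)
  have hXe : X ^ (2 + δ)⁻¹ = C ^ (2 + δ)⁻¹ * (m : ℝ) ^ (((L' : ℝ) + 1) / (2 + δ)) := by
    rw [hX, Real.mul_rpow hC0.le (by positivity), ← Real.rpow_natCast_mul hm0R,
      show ((L' + 1 : ℕ) : ℝ) * (2 + δ)⁻¹ = ((L' : ℝ) + 1) / (2 + δ) by push_cast; ring]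
  set n₁ : ℕ := ⌈X ^ (2 + δ)⁻¹⌉₊ with hn₁
  have hma : 1 ≤ (m : ℝ) ^ (((L' : ℝ) + 1) / (2 + δ)) := Real.one_le_rpow hm1R (by positivity)
  have hCe : 0 ≤ C ^ (2 + δ)⁻¹ := Real.rpow_nonneg hC0.le _
  have hnK : ((max n₀ n₁ : ℕ) : ℝ) ≤ K * (m : ℝ) ^ (((L' : ℝ) + 1) / (2 + δ)) := by
    rw [Nat.cast_max]
    refine max_le ?_ ?_
    · have h1 : (n₀ : ℝ) ≤ K := by rw [hK]; linarith
      calc (n₀ : ℝ) ≤ K := h1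
        _ = K * 1 := (mul_one K).symm
        _ ≤ K * (m : ℝ) ^ (((L' : ℝ) + 1) / (2 + δ)) := mul_le_mul_of_nonneg_left hma hK0.le
    · have h1 : (n₁ : ℝ) < X ^ (2 + δ)⁻¹ + 1 := Nat.ceil_lt_add_one (Real.rpow_nonneg hX0 _)
      rw [hXe] at h1
      have h2 : (0 : ℝ) ≤ (n₀ : ℝ) * (m : ℝ) ^ (((L' : ℝ) + 1) / (2 + δ)) := by positivity
      rw [hK]
      linarith
  refine ⟨max n₀ n₁, le_max_left _ _, ?_, ?_, ?_⟩
  · /- `n ≤ N` -/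
    have hr1R : (1 : ℝ) ≤ r := le_trans (Real.one_le_rpow hm1R (by linarith)) hr
    have hr1 : 1 ≤ r := by exact_mod_cast hr1R
    have hNat : r ^ L' ≤ (L' + 2) * N := pow_le_mul_of_words r L' N hr1 hN
    have hR : (m : ℝ) ^ ((1 / 2 - δ / 8) * L') ≤ ((L' : ℝ) + 2) * N := by
      rw [Real.rpow_mul_natCast hm0R]
      calc ((m : ℝ) ^ (1 / 2 - δ / 8)) ^ L' ≤ (r : ℝ) ^ L' :=
            pow_le_pow_left₀ (Real.rpow_nonneg hm0R _) hr L'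
        _ ≤ ((L' : ℝ) + 2) * N := by exact_mod_cast hNat
    have key : ((max n₀ n₁ : ℕ) : ℝ) * ((L' : ℝ) + 2) ≤ (N : ℝ) * ((L' : ℝ) + 2) := by
      calc ((max n₀ n₁ : ℕ) : ℝ) * ((L' : ℝ) + 2)
          ≤ K * (m : ℝ) ^ (((L' : ℝ) + 1) / (2 + δ)) * ((L' : ℝ) + 2) :=
            mul_le_mul_of_nonneg_right hnK (by positivity)
        _ = K * ((L' : ℝ) + 2) * (m : ℝ) ^ (((L' : ℝ) + 1) / (2 + δ)) := by ring
        _ ≤ (m : ℝ) ^ ((1 / 2 - δ / 8) * L') := hm₁ m hmm₁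
        _ ≤ ((L' : ℝ) + 2) * N := hR
        _ = (N : ℝ) * ((L' : ℝ) + 2) := mul_comm _ _
    have hle : ((max n₀ n₁ : ℕ) : ℝ) ≤ (N : ℝ) := le_of_mul_le_mul_right key (by positivity)
    exact_mod_cast hle
  · /- `p ≤ n ^ (2+δ)` -/
    have hpX : (p : ℝ) ≤ X := by
      have h : ((p : ℕ) : ℝ) ≤ ((2 * (3 ^ (L' + 1) * m ^ (L' + 1)) : ℕ) : ℝ) := by
        exact_mod_cast hp
      rw [hX, hC]
      push_cast at h
      linarith
    have hXn : X ^ (2 + δ)⁻¹ ≤ ((max n₀ n₁ : ℕ) : ℝ) :=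
      (Nat.le_ceil _).trans (by exact_mod_cast le_max_right n₀ n₁)
    calc (p : ℝ) ≤ X := hpX
      _ = (X ^ (2 + δ)⁻¹) ^ (2 + δ) := (Real.rpow_inv_rpow hX0 h2δ.ne').symm
      _ ≤ ((max n₀ n₁ : ℕ) : ℝ) ^ (2 + δ) :=
          Real.rpow_le_rpow (Real.rpow_nonneg hX0 _) hXn h2δ.le
  · /- `n ^ (2-δ) ≤ (m ^ (1-ε)) ^ L` -/
    calc ((max n₀ n₁ : ℕ) : ℝ) ^ (2 - δ)
        ≤ (K * (m : ℝ) ^ (((L' : ℝ) + 1) / (2 + δ))) ^ (2 - δ) :=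
          Real.rpow_le_rpow (by positivity) hnK (by linarith)
      _ = K ^ (2 - δ) * (m : ℝ) ^ (((L' : ℝ) + 1) / (2 + δ) * (2 - δ)) := by
          rw [Real.mul_rpow hK0.le (Real.rpow_nonneg hm0R _), Real.rpow_mul hm0R]
      _ ≤ (m : ℝ) ^ ((1 - δ / 8) * ((L' : ℝ) + 1)) := hm₂ m hmm₂
      _ = ((m : ℝ) ^ (1 - δ / 8)) ^ (L' + 1) := by
          rw [← Real.rpow_mul_natCast hm0R, Nat.cast_add_one]

end Summit.MatrixMultiplication.MatrixMultiplication.Theorems.PrimeTwoFamilies.LadderLift
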